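import Mathlib.RingTheory.LaurentSeries
import Mathlib.RingTheory.Derivation.Basic
import Mathlib.RingTheory.PowerSeries.Inverse
import Mathlib.Algebra.Polynomial.Derivation
import Literature.NumberTheory.Transcendental.AxDerivationTools
import HarnessLib

/-!
# The Euler operator `t·d/dt` on Laurent series and the residue formula
# `CT(θf/f) = ord f`

Trunk T-TRANSCEND (`Literature/NumberTheory/Transcendental`). Support for the transcendence
input of Ax's theorem (J. Ax, *On Schanuel's conjectures*, Ann. of Math. 93 (1971), §2,
proof of Prop. 1: expansion in powers of a uniformiser; M. Rosenlicht, Pacific J. Math. 65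
(1976), proof of Prop. 4: "write `v` as a partial fraction … compare terms"). All folklore:

* `Literature.LaurentEuler.eulerDerivation R`: the derivation `θ = t·d/dt` of the ring of Laurent
  series `R⸨t⸩`, `θ (∑ aₙ tⁿ) = ∑ n aₙ tⁿ` (a diagonal operator, so the Leibniz rule is the
  identity `n = i + j` on the antidiagonal).
* `Literature.NumberTheory.Transcendental.LaurentEuler.coeff_zero_eulerDerivation`: `θ f` has no constant term.
* `Literature.NumberTheory.Transcendental.LaurentEuler.coeff_zero_eulerDerivation_mul_inv`: for `f ≠ 0` over a field,
  the constant term of the logarithmic derivative `θf / f` is the order `ord f ∈ ℤ` of `f`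
  (write `f = tᵐ · P` with `P` an invertible power series).

## References

* J. Ax, *On Schanuel's conjectures*, Ann. of Math. 93 (1971), 252–268, §2.
* M. Rosenlicht, *On Liouville's theory of elementary functions*, Pacific J. Math. 65 (1976),
  485–492, Prop. 4.
-/

noncomputable section

open HahnSeries
open scoped LaurentSeries PowerSeries

namespace Literature.NumberTheory.Transcendental

namespace LaurentEuler

section Ring

variable {R : Type*} [CommRing R]

/-- The Euler operator `θ = t·d/dt` on Laurent series as a function:
`(θ f)ₙ = n · fₙ`. [folklore] -/
def eulerFun (f : R⸨X⸩) : R⸨X⸩ where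
  coeff n := (n : R) * f.coeff n
  isPWO_support' := f.isPWO_support.mono fun n hn => by
    simp only [Function.mem_support, ne_eq] at hn ⊢
    exact fun h => hn (by rw [h, mul_zero])

/-- Coefficients of `θ f`. [folklore] -/
@[simp] theorem coeff_eulerFun (f : R⸨X⸩) (n : ℤ) : (eulerFun f).coeff n = (n : R) * f.coeff n :=
  rfl

/-- The support of `θ f` is contained in that of `f`. [folklore] -/
theorem support_eulerFun_subset (f : R⸨X⸩) : (eulerFun f).support ⊆ f.support := fun n hn => by
  simp only [HahnSeries.mem_support, coeff_eulerFun, ne_eq] at hn ⊢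
  exact fun h => hn (by rw [h, mul_zero])

/-- Leibniz rule for `θ`: on the antidiagonal `i + j = n` one has `n fᵢ gⱼ = (i fᵢ) gⱼ + fᵢ (j gⱼ)`.
[folklore] -/
theorem eulerFun_mul (f g : R⸨X⸩) : eulerFun (f * g) = eulerFun f * g + f * eulerFun g := by
  ext n
  rw [HahnSeries.coeff_add, coeff_eulerFun, HahnSeries.coeff_mul,
    HahnSeries.coeff_mul_left' f.isPWO_support (support_eulerFun_subset f),
    HahnSeries.coeff_mul_right' g.isPWO_support (support_eulerFun_subset g), Finset.mul_sum,
    ← Finset.sum_add_distrib]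
  refine Finset.sum_congr rfl fun ij hij => ?_
  rw [Finset.mem_antidiagonal] at hij
  obtain ⟨-, -, hsum⟩ := hij
  rw [coeff_eulerFun, coeff_eulerFun, ← hsum, Int.cast_add]
  ring

variable (R) in
/-- **The Euler derivation `θ = t·d/dt` of `R⸨t⸩`** (an `R`-derivation).
[folklore] -/
def eulerDerivation : Derivation R R⸨X⸩ R⸨X⸩ where
  toFun := eulerFun
  map_add' f g := by
    ext n
    simp only [coeff_eulerFun, HahnSeries.coeff_add, mul_add]
  map_smul' c f := by
    rw [RingHom.id_apply, Algebra.smul_def, ← HahnSeries.C_mul_eq_smul, HahnSeries.algebraMap_apply',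
      PowerSeries.algebraMap_eq, HahnSeries.ofPowerSeries_C, eulerFun_mul]
    have h3 : eulerFun (HahnSeries.C c) = 0 := by
      ext n
      rw [coeff_eulerFun, HahnSeries.coeff_zero, HahnSeries.C_apply]
      rcases eq_or_ne n 0 with rfl | hn
      · simp
      · rw [HahnSeries.coeff_single_of_ne hn, mul_zero]
    rw [h3, zero_mul, zero_add]
  map_one_eq_zero' := by
    ext n
    simp only [HahnSeries.coeff_zero]
    change (n : R) * (1 : R⸨X⸩).coeff n = 0
    rcases eq_or_ne n 0 with rfl | hn
    · simp
    · rw [← HahnSeries.single_zero_one, HahnSeries.coeff_single_of_ne hn, mul_zero]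
  leibniz' f g := by
    change eulerFun (f * g) = f • eulerFun g + g • eulerFun f
    rw [eulerFun_mul, smul_eq_mul, smul_eq_mul, add_comm, mul_comm g]

/-- Coefficients of `θ f`. [folklore] -/
@[simp] theorem coeff_eulerDerivation (f : R⸨X⸩) (n : ℤ) :
    (eulerDerivation R f).coeff n = (n : R) * f.coeff n :=
  rfl

/-- `θ f` has zero constant term. [folklore] -/
theorem coeff_zero_eulerDerivation (f : R⸨X⸩) : (eulerDerivation R f).coeff 0 = 0 := by
  simp

/-- `θ (a tᵐ) = m a tᵐ`. [folklore] -/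
theorem eulerDerivation_single (m : ℤ) (a : R) :
    eulerDerivation R (single m a) = single m ((m : R) * a) := by
  ext n
  rw [coeff_eulerDerivation, HahnSeries.coeff_single, HahnSeries.coeff_single]
  split_ifs with h
  · rw [h]
  · rw [mul_zero]

/-- `θ` of a power series is the power series `∑ n aₙ tⁿ`; in particular it is again a power
series, with zero constant term. [folklore] -/
theorem eulerDerivation_ofPowerSeries (q : PowerSeries R) :
    eulerDerivation R (q : R⸨X⸩) =
      ((PowerSeries.mk fun n => (n : R) * PowerSeries.coeff n q : PowerSeries R) : R⸨X⸩) := by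
  ext n
  rw [coeff_eulerDerivation, PowerSeries.coeff_coe, PowerSeries.coeff_coe]
  split_ifs with h
  · rw [mul_zero]
  · rw [PowerSeries.coeff_mk]
    push Not at h
    congr 1
    rw [← Int.cast_natCast n.natAbs, Int.natAbs_of_nonneg h]

end Ring

section Field

variable {K : Type*} [Field K]

/-- The inverse of an invertible power series, computed in Laurent series, is the coercion of
its power-series inverse. [folklore] -/
theorem inv_coe_eq_coe_inv (q : PowerSeries K) (hq : PowerSeries.constantCoeff q ≠ 0) :
    ((q : K⸨X⸩))⁻¹ = ((q⁻¹ : PowerSeries K) : K⸨X⸩) := by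
  symm
  apply eq_inv_of_mul_eq_one_right
  rw [← PowerSeries.coe_mul, PowerSeries.mul_inv_cancel q hq, PowerSeries.coe_one]

/-- **Residue formula.** For a non-zero Laurent series `f` over a field, the constant term of the
logarithmic derivative `θf · f⁻¹` (`θ = t·d/dt`) is the order of `f`:
writing `f = tᵐ P` with `P(0) ≠ 0`, `θf/f = m + θP/P` and `θP/P` is a power series without
constant term. [folklore] -/
theorem coeff_zero_eulerDerivation_mul_inv {f : K⸨X⸩} (hf : f ≠ 0) :
    (eulerDerivation K f * f⁻¹).coeff 0 = (f.order : K) := by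
  set m := f.order with hm
  set q := LaurentSeries.powerSeriesPart f with hq
  have hq0 : PowerSeries.constantCoeff q ≠ 0 := by
    rw [← PowerSeries.coeff_zero_eq_constantCoeff_apply, hq,
      LaurentSeries.powerSeriesPart_coeff, Nat.cast_zero, add_zero]
    exact HahnSeries.coeff_order_eq_zero.not.mpr hf
  have hP0 : (q : K⸨X⸩) ≠ 0 := fun h => by
    apply hq0
    have := congrArg (fun x : K⸨X⸩ => x.coeff 0) h
    simp only [HahnSeries.coeff_zero] at this
    rw [← this, ← PowerSeries.coeff_zero_eq_constantCoeff_apply]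
    exact (LaurentSeries.coeff_coe_powerSeries q 0).symm
  have hs0 : (single m (1 : K) : K⸨X⸩) ≠ 0 := by
    rw [ne_eq, HahnSeries.single_eq_zero_iff]; exact one_ne_zero
  have hf' : f = single m 1 * (q : K⸨X⸩) := (LaurentSeries.single_order_mul_powerSeriesPart f).symm
  -- `θ f · f⁻¹ = m + θP · P⁻¹`
  have key : eulerDerivation K f * f⁻¹ = single 0 (m : K) +
      eulerDerivation K (q : K⸨X⸩) * ((q : K⸨X⸩))⁻¹ := by
    have h1 : eulerDerivation K f = single m 1 * eulerDerivation K (q : K⸨X⸩) +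
        (q : K⸨X⸩) * single m (m : K) := by
      conv_lhs => rw [hf']
      rw [Derivation.leibniz, eulerDerivation_single, smul_eq_mul, smul_eq_mul, mul_one]
    have h2 : f⁻¹ = ((q : K⸨X⸩))⁻¹ * (single m (1 : K))⁻¹ := by rw [hf', mul_inv, mul_comm]
    have h3 : single m (m : K) * (single m (1 : K))⁻¹ = single 0 (m : K) := by
      rw [HahnSeries.inv_single, HahnSeries.single_mul_single, add_neg_cancel, inv_one, mul_one]
    calc eulerDerivation K f * f⁻¹
        = eulerDerivation K (q : K⸨X⸩) * ((q : K⸨X⸩))⁻¹ * (single m 1 * (single m (1 : K))⁻¹) +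
            single m (m : K) * (single m (1 : K))⁻¹ * ((q : K⸨X⸩) * ((q : K⸨X⸩))⁻¹) := by
          rw [h1, h2]; ring
      _ = single 0 (m : K) + eulerDerivation K (q : K⸨X⸩) * ((q : K⸨X⸩))⁻¹ := by
          rw [mul_inv_cancel₀ hs0, mul_inv_cancel₀ hP0, mul_one, mul_one, h3, add_comm]
  rw [key, HahnSeries.coeff_add, HahnSeries.coeff_single_same]
  have h4 : (eulerDerivation K (q : K⸨X⸩) * ((q : K⸨X⸩))⁻¹).coeff 0 = 0 := by
    rw [inv_coe_eq_coe_inv q hq0, eulerDerivation_ofPowerSeries, ← PowerSeries.coe_mul]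
    have h5 := LaurentSeries.coeff_coe_powerSeries
      ((PowerSeries.mk fun n => (n : K) * PowerSeries.coeff n q) * q⁻¹) 0
    rw [Nat.cast_zero] at h5
    rw [h5, PowerSeries.coeff_mul, Finset.Nat.antidiagonal_zero, Finset.sum_singleton,
      PowerSeries.coeff_mk, Nat.cast_zero, zero_mul, zero_mul]
  rw [h4, add_zero]

end Field


/-! ### Rational functions: `t·d/dt` on `F(t)` and constant terms of logarithmic derivatives -/

section RatFunc

open RatFunc Polynomial

variable {F : Type*} [Field F]

/-- `F ↪ F⸨X⸩` sends `c` to the constant series. [folklore] -/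
theorem algebraMap_laurent_eq_C (c : F) : algebraMap F F⸨X⸩ c = HahnSeries.C c := by
  rw [HahnSeries.algebraMap_apply', PowerSeries.algebraMap_eq, HahnSeries.ofPowerSeries_C]

/-- `F[X] ↪ F⸨X⸩` sends the constant polynomial `c` to the constant series. [folklore] -/
theorem algebraMap_polynomial_laurent_C (c : F) :
    algebraMap F[X] F⸨X⸩ (Polynomial.C c) = HahnSeries.C c := by
  rw [HahnSeries.algebraMap_apply', PowerSeries.algebraMap_apply', Polynomial.coe_C,
    PowerSeries.map_C, Algebra.algebraMap_self, RingHom.id_apply, HahnSeries.ofPowerSeries_C]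

/-- `F(X) ↪ F⸨X⸩` sends the constant `c` to the constant series. [folklore] -/
theorem coe_ratFunc_C (c : F) : ((RatFunc.C c : RatFunc F) : F⸨X⸩) = HahnSeries.C c := by
  rw [← RatFunc.algebraMap_C, ← IsScalarTower.algebraMap_apply F[X] (RatFunc F) F⸨X⸩,
    algebraMap_polynomial_laurent_C]

/-- The embedding `F(X) ↪ F⸨X⸩` intertwines every `F`-derivation `θ` of `F(X)` with `θ X = X`
(i.e. `θ = X·d/dX`) with the Euler derivation of `F⸨X⸩`: check on constants and on `X`, then
on polynomials by additivity and the Leibniz rule, then on quotients. [folklore] -/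
theorem coe_derivation_eq_eulerDerivation (θ : Derivation F (RatFunc F) (RatFunc F))
    (hθ : θ RatFunc.X = RatFunc.X) (U : RatFunc F) :
    ((θ U : RatFunc F) : F⸨X⸩) = eulerDerivation F (U : F⸨X⸩) := by
  have hT : eulerDerivation F (single 1 (1 : F)) = single 1 1 := by
    rw [eulerDerivation_single, Int.cast_one, mul_one]
  -- polynomials
  have hpoly : ∀ p : F[X], ((θ (algebraMap F[X] (RatFunc F) p) : RatFunc F) : F⸨X⸩) =
      eulerDerivation F ((algebraMap F[X] (RatFunc F) p : RatFunc F) : F⸨X⸩) := by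
    intro p
    induction p using Polynomial.induction_on with
    | C c =>
      rw [RatFunc.algebraMap_C, ← RatFunc.algebraMap_eq_C, θ.map_algebraMap, map_zero,
        RatFunc.algebraMap_eq_C, coe_ratFunc_C, ← algebraMap_laurent_eq_C,
        (eulerDerivation F).map_algebraMap]
    | add p q hp hq => rw [map_add, map_add, map_add, hp, hq, map_add, map_add]
    | monomial n c ih =>
      set a := algebraMap F[X] (RatFunc F) (Polynomial.C c * Polynomial.X ^ n) with ha
      have h1 : algebraMap F[X] (RatFunc F) (Polynomial.C c * Polynomial.X ^ (n + 1)) = a * RatFunc.X := by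
        rw [pow_succ, ← mul_assoc, map_mul, RatFunc.algebraMap_X]
      set ψ := algebraMap (RatFunc F) F⸨X⸩ with hψ
      have hX : ψ RatFunc.X = single 1 1 := RatFunc.coe_X
      rw [h1, Derivation.leibniz, smul_eq_mul, smul_eq_mul, hθ, ψ.map_add, ψ.map_mul, ψ.map_mul,
        ih, hX, Derivation.leibniz, hT, smul_eq_mul, smul_eq_mul]
  -- quotients
  induction U using RatFunc.induction_on with
  | f p q hq =>
    rw [Derivation.leibniz_div, map_div₀ (algebraMap (RatFunc F) F⸨X⸩), Derivation.leibniz_div]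
    simp only [smul_eq_mul, map_mul, map_sub, map_pow, map_inv₀, hpoly]

/-- Constant terms: for `U ≠ 0` in `F(X)`, the constant term of (the Laurent expansion of)
`θU/U` is the order of `U` at `X = 0`, an integer. [folklore] -/
theorem coeff_zero_coe_derivation_div (θ : Derivation F (RatFunc F) (RatFunc F))
    (hθ : θ RatFunc.X = RatFunc.X) {U : RatFunc F} (hU : U ≠ 0) :
    ((θ U / U : RatFunc F) : F⸨X⸩).coeff 0 = ((U : F⸨X⸩).order : F) := by
  have hU' : (U : F⸨X⸩) ≠ 0 := (map_ne_zero (algebraMap (RatFunc F) F⸨X⸩)).mpr hU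
  rw [map_div₀, coe_derivation_eq_eulerDerivation θ hθ, div_eq_mul_inv]
  exact coeff_zero_eulerDerivation_mul_inv hU'

/-- Constant terms: `θV` has zero constant term for every `V ∈ F(X)`. [folklore] -/
theorem coeff_zero_coe_derivation (θ : Derivation F (RatFunc F) (RatFunc F))
    (hθ : θ RatFunc.X = RatFunc.X) (V : RatFunc F) :
    ((θ V : RatFunc F) : F⸨X⸩).coeff 0 = 0 := by
  rw [coe_derivation_eq_eulerDerivation θ hθ, coeff_zero_eulerDerivation]

/-- Constant terms: a constant `c ∈ F` has constant term `c`. [folklore] -/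
theorem coeff_zero_coe_C (c : F) : ((RatFunc.C c : RatFunc F) : F⸨X⸩).coeff 0 = c := by
  rw [coe_ratFunc_C, HahnSeries.C_apply, HahnSeries.coeff_single_same]

end RatFunc

end LaurentEuler

end Literature.NumberTheory.Transcendental
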